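import Mathlib
import HarnessLib
import Summits.Ventures.LatticeQCDFlow.Scoring.MarkovChainBivariateCLT
import Summits.Ventures.LatticeQCDFlow.Scoring.RatioDeltaMethod
import Summits.Ventures.LatticeQCDFlow.Exactness.NCMCGeneralSpaceIndicatorCLT

/-!
# THE CLT OF A RATIO OF TWO CHAIN AVERAGES under a Doeblin power, from any initial law:
# `√n (Σ_{t<n} f(X_t) / Σ_{t<n} g(X_t) − πf/πg) ⇒ N(0, (σ²_f − 2r σ_{fg} + r² σ²_g)/(πg)²)`, `r = πf/πg`

HONEST FRAMING: exact (Metropolis-corrected) sampling algorithms for lattice gauge theory;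
figures of merit are autocorrelation/cost numbers at stated couplings and volumes; no
continuum-physics claim.

Venture `LatticeQCDFlow` (cell pub-lqcd), topic `Scoring`; FANOUT row 8 (`s0-cpn-nemc`, GEN-22).
NEW WORK of the cell, not a published result; no definition is introduced; nothing is cited as a
fact.  Reweighting and non-equilibrium estimators print RATIOS of two averages along ONE chain
(`⟨O w⟩/⟨w⟩`, an acceptance-normalised observable, a susceptibility ratio); the two averages are
correlated, so the error bar of the ratio needs the long-run cross-covariance `σ_{fg}`
(`Scoring/GreenKuboCrossCovariance.lean`).  From the bivariate Markov-chain CLT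
(`Scoring/MarkovChainBivariateCLT.chain_bivariate_clt_of_nHit`) and the delta method for a ratio
(`Scoring/RatioDeltaMethod.tendstoInDistribution_ratio_deltaMethod`): for every kernel with a
Doeblin power `(nHit κ m)(z, ·) ≥ ε ν`, `π` invariant with `πg ≠ 0`, bounded measurable `f, g` and
EVERY initial law, `√n (Σ_{t<n} f(x_t) / Σ_{t<n} g(x_t) − πf/πg) ⇒ Z₁/πg − πf Z₂/(πg)²` for any
Gaussian pair `(Z₁, Z₂)` of the bivariate CLT, and that limit is
`N(0, (σ²_f − 2r σ_{fg} + r² σ²_g)/(πg)²)` with `r = πf/πg`; such a pair exists, so the ratio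
statistic converges in distribution to a centred Gaussian of that variance.  The ratio of the sums
is the ratio of the time averages (`n` cancels; at `n = 0` both sides are the junk value `0`).
Printed counterparts NAMED ONLY: delta-method error bars for ratio / reweighting estimators in
MCMC (Ferrenberg–Swendsen 1989; Wolff 2004 §3), nothing cited as a fact.

## Content (`P_{μ₀}` the path law; `u = πf`, `v = πg ≠ 0`, `r = u/v`)

* `avg_div_avg_eq` — the ratio of the averages is the ratio of the sums (the companion
  `√n ((Σ a_t)/n − u) = (√n)⁻¹ Σ (a_t − u)` is row 13's `Exactness.GeneralNCMC.sqrt_mul_mean_sub_eq`);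
* **`chain_ratio_clt_of_nHit`** — for any a.e.-measurable pair `(Z₁, Z₂)` with
  `u' Z₁ + v' Z₂ ~ N(0, u'² σ²_f + 2u'v' σ_{fg} + v'² σ²_g)` (all `u', v'`):
  `√n (Σ f(x_t)/Σ g(x_t) − u/v) ⇒ Z₁/v − u Z₂/v²` under `P_{μ₀}`;
* `hasLaw_ratio_limit` — that limit is `N(0, (σ²_f − 2r σ_{fg} + r² σ²_g)/v²)`;
* **`chain_ratio_clt_exists_of_nHit`** — `∃ Y ~ N(0, (σ²_f − 2r σ_{fg} + r² σ²_g)/v²)` on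
  `(ℝ², N(0,1)²)` with `√n (Σ f(x_t)/Σ g(x_t) − u/v) ⇒ Y` under `P_{μ₀}`.

NOT CLAIMED: a studentised version (plug-in of the batch-means covariance matrix,
`Scoring/BatchMeansCrossCovariance.lean`, is the next file); `πg = 0`; unbounded observables;
any number of ours.
-/

noncomputable section

namespace Summit.Ventures.LatticeQCDFlow.Scoring

open MeasureTheory ProbabilityTheory Filter Finset Preorder
open scoped ENNReal Topology

/-! ### Averages versus sums -/

section Algebra

/-- The ratio of the time averages is the ratio of the sums (every `n`). -/
theorem avg_div_avg_eq (a b : ℕ → ℝ) (n : ℕ) :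
    ((∑ t ∈ Finset.range n, a t) / n) / ((∑ t ∈ Finset.range n, b t) / n)
      = (∑ t ∈ Finset.range n, a t) / ∑ t ∈ Finset.range n, b t := by
  rcases Nat.eq_zero_or_pos n with hn | hn
  · subst hn; simp
  · exact div_div_div_cancel_right₀ (Nat.cast_pos.2 hn).ne' _ _

end Algebra

variable {Ω : Type*} [MeasurableSpace Ω]
  {κ : Kernel Ω Ω} [IsMarkovKernel κ] {ν : Measure Ω} [IsProbabilityMeasure ν] {ε : ℝ≥0∞} {m : ℕ}

/-! ### The ratio CLT -/

section Ratio

/-- **THE RATIO CLT, FROM ANY INITIAL LAW.**  `π` invariant, `(nHit κ m)(z,·) ≥ ε ν` (`0 < ε ≤ 1`,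
`0 < m`), `|f| ≤ C_f`, `|g| ≤ C_g` measurable, `πg ≠ 0`; `(Z₁, Z₂)` any a.e.-measurable pair with
`u' Z₁ + v' Z₂ ~ N(0, u'² σ²_f + 2u'v' σ_{fg} + v'² σ²_g)` for all `u', v'`.  Then
`√n (Σ_{t<n} f(x_t) / Σ_{t<n} g(x_t) − πf/πg) ⇒ Z₁/πg − πf · Z₂/(πg)²` under `P_{μ₀}`. -/
theorem chain_ratio_clt_of_nHit {π : Measure Ω} [IsProbabilityMeasure π]
    (hπ : Kernel.Invariant κ π) (hmin : ∀ z, ε • ν ≤ Exactness.nHit κ m z) (hε0 : 0 < ε)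
    (hε1 : ε ≤ 1) (hm : 0 < m)
    {f g : Ω → ℝ} (hf : Measurable f) (hg : Measurable g) {Cf Cg : ℝ} (hCf : ∀ x, |f x| ≤ Cf)
    (hCg : ∀ x, |g x| ≤ Cg) (hv : ∫ z, g z ∂π ≠ 0) (μ₀ : Measure Ω) [IsProbabilityMeasure μ₀]
    {Ω' : Type*} [MeasurableSpace Ω'] {P' : Measure Ω'} [IsProbabilityMeasure P'] {Z₁ Z₂ : Ω' → ℝ}
    (hZ₁ : AEMeasurable Z₁ P') (hZ₂ : AEMeasurable Z₂ P')
    (hZ : ∀ u v : ℝ, HasLaw (fun ω => u * Z₁ ω + v * Z₂ ω) (gaussianReal 0 (Real.toNNReal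
        (u ^ 2 * ((∫ y, (f y - ∫ z, f z ∂π) ^ 2 ∂π)
            + 2 * ∑' k, ∫ y, (f y - ∫ z, f z ∂π) * (kop κ)^[k + 1] (fun y => f y - ∫ z, f z ∂π) y ∂π)
          + 2 * (u * v) * ((∫ y, (f y - ∫ z, f z ∂π) * (g y - ∫ z, g z ∂π) ∂π)
            + ∑' k, ((∫ y, (f y - ∫ z, f z ∂π) * (kop κ)^[k + 1] (fun y => g y - ∫ z, g z ∂π) y ∂π)
              + ∫ y, (g y - ∫ z, g z ∂π) * (kop κ)^[k + 1] (fun y => f y - ∫ z, f z ∂π) y ∂π))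
          + v ^ 2 * ((∫ y, (g y - ∫ z, g z ∂π) ^ 2 ∂π)
            + 2 * ∑' k, ∫ y, (g y - ∫ z, g z ∂π) * (kop κ)^[k + 1] (fun y => g y - ∫ z, g z ∂π) y ∂π)))) P')
    [IsProbabilityMeasure (Kernel.trajMeasure (X := fun _ : ℕ => Ω) μ₀
          (fun n : ℕ => κ.comap (fun h : (i : ↥(Finset.Iic n)) → Ω => h ⟨n, Finset.mem_Iic.2 le_rfl⟩)
            (measurable_pi_apply _)))] :
    TendstoInDistribution (fun (n : ℕ) (x : ℕ → Ω) =>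
        Real.sqrt n * ((∑ t ∈ Finset.range n, f (x t)) / (∑ t ∈ Finset.range n, g (x t))
          - (∫ z, f z ∂π) / (∫ z, g z ∂π)))
      atTop (fun ω => Z₁ ω / (∫ z, g z ∂π) - (∫ z, f z ∂π) * Z₂ ω / (∫ z, g z ∂π) ^ 2)
      (fun _ => (Kernel.trajMeasure (X := fun _ : ℕ => Ω) μ₀
          (fun n : ℕ => κ.comap (fun h : (i : ↥(Finset.Iic n)) → Ω => h ⟨n, Finset.mem_Iic.2 le_rfl⟩)
            (measurable_pi_apply _)))) P' := by
  have hJ := chain_bivariate_clt_of_nHit hπ hmin hε0 hε1 hm hf hg hCf hCg μ₀ hZ₁ hZ₂ hZ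
  -- the scaled centred sums are the scaled errors of the averages
  have hJ' : TendstoInDistribution (fun (n : ℕ) (x : ℕ → Ω) =>
      (Real.sqrt n * ((∑ t ∈ Finset.range n, f (x t)) / n - ∫ z, f z ∂π),
        Real.sqrt n * ((∑ t ∈ Finset.range n, g (x t)) / n - ∫ z, g z ∂π)))
      atTop (fun ω => (Z₁ ω, Z₂ ω)) (fun _ => (Kernel.trajMeasure (X := fun _ : ℕ => Ω) μ₀
          (fun n : ℕ => κ.comap (fun h : (i : ↥(Finset.Iic n)) → Ω => h ⟨n, Finset.mem_Iic.2 le_rfl⟩)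
            (measurable_pi_apply _)))) P' := by
    refine hJ.congr (fun n => Eventually.of_forall fun x => ?_) EventuallyEq.rfl
    show ((Real.sqrt n)⁻¹ * ∑ t ∈ Finset.range n, (f (x t) - ∫ z, f z ∂π),
        (Real.sqrt n)⁻¹ * ∑ t ∈ Finset.range n, (g (x t) - ∫ z, g z ∂π))
      = (Real.sqrt n * ((∑ t ∈ Finset.range n, f (x t)) / n - ∫ z, f z ∂π),
        Real.sqrt n * ((∑ t ∈ Finset.range n, g (x t)) / n - ∫ z, g z ∂π))
    rw [Exactness.GeneralNCMC.sqrt_mul_mean_sub_eq, Exactness.GeneralNCMC.sqrt_mul_mean_sub_eq]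
  have hUm : ∀ n : ℕ, AEMeasurable (fun x : ℕ → Ω => (∑ t ∈ Finset.range n, f (x t)) / n)
      (Kernel.trajMeasure (X := fun _ : ℕ => Ω) μ₀
          (fun n : ℕ => κ.comap (fun h : (i : ↥(Finset.Iic n)) → Ω => h ⟨n, Finset.mem_Iic.2 le_rfl⟩)
            (measurable_pi_apply _))) := fun n =>
    ((Finset.measurable_sum _ fun t _ => hf.comp (measurable_pi_apply t)).div_const _).aemeasurable
  have hVm : ∀ n : ℕ, AEMeasurable (fun x : ℕ → Ω => (∑ t ∈ Finset.range n, g (x t)) / n)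
      (Kernel.trajMeasure (X := fun _ : ℕ => Ω) μ₀
          (fun n : ℕ => κ.comap (fun h : (i : ↥(Finset.Iic n)) → Ω => h ⟨n, Finset.mem_Iic.2 le_rfl⟩)
            (measurable_pi_apply _))) := fun n =>
    ((Finset.measurable_sum _ fun t _ => hg.comp (measurable_pi_apply t)).div_const _).aemeasurable
  have hd := CardConsistency.tendstoInDistribution_ratio_deltaMethod (u := ∫ z, f z ∂π) hv
    (Real.tendsto_sqrt_atTop.comp tendsto_natCast_atTop_atTop) hJ' hUm hVm
  refine hd.congr (fun n => Eventually.of_forall fun x => ?_) EventuallyEq.rfl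
  show Real.sqrt n * ((∑ t ∈ Finset.range n, f (x t)) / n / ((∑ t ∈ Finset.range n, g (x t)) / n)
      - (∫ z, f z ∂π) / (∫ z, g z ∂π))
    = Real.sqrt n * ((∑ t ∈ Finset.range n, f (x t)) / (∑ t ∈ Finset.range n, g (x t))
      - (∫ z, f z ∂π) / (∫ z, g z ∂π))
  rw [avg_div_avg_eq]

omit [IsMarkovKernel κ] in
/-- **THE LAW OF THE RATIO LIMIT**: if `u' Z₁ + v' Z₂ ~ N(0, u'² σ²_f + 2u'v' σ_{fg} + v'² σ²_g)` for
all `u', v'` and `v = πg ≠ 0`, then `Z₁/v − u Z₂/v² ~ N(0, (σ²_f − 2r σ_{fg} + r² σ²_g)/v²)`,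
`r = u/v`, `u = πf`. -/
theorem hasLaw_ratio_limit {π : Measure Ω} {f g : Ω → ℝ} (hv : ∫ z, g z ∂π ≠ 0)
    {Ω' : Type*} [MeasurableSpace Ω'] {P' : Measure Ω'} {Z₁ Z₂ : Ω' → ℝ}
    (hZ : ∀ u v : ℝ, HasLaw (fun ω => u * Z₁ ω + v * Z₂ ω) (gaussianReal 0 (Real.toNNReal
        (u ^ 2 * ((∫ y, (f y - ∫ z, f z ∂π) ^ 2 ∂π)
            + 2 * ∑' k, ∫ y, (f y - ∫ z, f z ∂π) * (kop κ)^[k + 1] (fun y => f y - ∫ z, f z ∂π) y ∂π)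
          + 2 * (u * v) * ((∫ y, (f y - ∫ z, f z ∂π) * (g y - ∫ z, g z ∂π) ∂π)
            + ∑' k, ((∫ y, (f y - ∫ z, f z ∂π) * (kop κ)^[k + 1] (fun y => g y - ∫ z, g z ∂π) y ∂π)
              + ∫ y, (g y - ∫ z, g z ∂π) * (kop κ)^[k + 1] (fun y => f y - ∫ z, f z ∂π) y ∂π))
          + v ^ 2 * ((∫ y, (g y - ∫ z, g z ∂π) ^ 2 ∂π)
            + 2 * ∑' k, ∫ y, (g y - ∫ z, g z ∂π) * (kop κ)^[k + 1] (fun y => g y - ∫ z, g z ∂π) y ∂π)))) P') :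
    HasLaw (fun ω => Z₁ ω / (∫ z, g z ∂π) - (∫ z, f z ∂π) * Z₂ ω / (∫ z, g z ∂π) ^ 2)
      (gaussianReal 0 (Real.toNNReal ((((∫ y, (f y - ∫ z, f z ∂π) ^ 2 ∂π)
            + 2 * ∑' k, ∫ y, (f y - ∫ z, f z ∂π) * (kop κ)^[k + 1] (fun y => f y - ∫ z, f z ∂π) y ∂π)
          - 2 * ((∫ z, f z ∂π) / (∫ z, g z ∂π)) * ((∫ y, (f y - ∫ z, f z ∂π) * (g y - ∫ z, g z ∂π) ∂π)
            + ∑' k, ((∫ y, (f y - ∫ z, f z ∂π) * (kop κ)^[k + 1] (fun y => g y - ∫ z, g z ∂π) y ∂π)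
              + ∫ y, (g y - ∫ z, g z ∂π) * (kop κ)^[k + 1] (fun y => f y - ∫ z, f z ∂π) y ∂π))
          + ((∫ z, f z ∂π) / (∫ z, g z ∂π)) ^ 2 * ((∫ y, (g y - ∫ z, g z ∂π) ^ 2 ∂π)
            + 2 * ∑' k, ∫ y, (g y - ∫ z, g z ∂π) * (kop κ)^[k + 1] (fun y => g y - ∫ z, g z ∂π) y ∂π))
          / (∫ z, g z ∂π) ^ 2))) P' := by
  have e : (fun ω => Z₁ ω / (∫ z, g z ∂π) - (∫ z, f z ∂π) * Z₂ ω / (∫ z, g z ∂π) ^ 2)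
      = fun ω => (∫ z, g z ∂π)⁻¹ * Z₁ ω + (-((∫ z, f z ∂π) / (∫ z, g z ∂π) ^ 2)) * Z₂ ω := by
    funext ω; ring
  have h := hZ (∫ z, g z ∂π)⁻¹ (-((∫ z, f z ∂π) / (∫ z, g z ∂π) ^ 2))
  rw [e]
  convert h using 4
  field_simp
  ring

/-- **THE RATIO CLT IS NOT VACUOUS.**  Same hypotheses on the chain, `πg ≠ 0`: there is `Y` on
`(ℝ × ℝ, N(0,1) ⊗ N(0,1))` with `Y ~ N(0, (σ²_f − 2r σ_{fg} + r² σ²_g)/(πg)²)` (`r = πf/πg`) and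
`√n (Σ_{t<n} f(x_t) / Σ_{t<n} g(x_t) − πf/πg) ⇒ Y` under `P_{μ₀}`, for every initial law `μ₀`. -/
theorem chain_ratio_clt_exists_of_nHit {π : Measure Ω} [IsProbabilityMeasure π]
    (hπ : Kernel.Invariant κ π) (hmin : ∀ z, ε • ν ≤ Exactness.nHit κ m z) (hε0 : 0 < ε)
    (hε1 : ε ≤ 1) (hm : 0 < m)
    {f g : Ω → ℝ} (hf : Measurable f) (hg : Measurable g) {Cf Cg : ℝ} (hCf : ∀ x, |f x| ≤ Cf)
    (hCg : ∀ x, |g x| ≤ Cg) (hv : ∫ z, g z ∂π ≠ 0) (μ₀ : Measure Ω) [IsProbabilityMeasure μ₀]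
    [IsProbabilityMeasure (Kernel.trajMeasure (X := fun _ : ℕ => Ω) μ₀
          (fun n : ℕ => κ.comap (fun h : (i : ↥(Finset.Iic n)) → Ω => h ⟨n, Finset.mem_Iic.2 le_rfl⟩)
            (measurable_pi_apply _)))] :
    ∃ Y : ℝ × ℝ → ℝ, HasLaw Y (gaussianReal 0 (Real.toNNReal ((((∫ y, (f y - ∫ z, f z ∂π) ^ 2 ∂π)
            + 2 * ∑' k, ∫ y, (f y - ∫ z, f z ∂π) * (kop κ)^[k + 1] (fun y => f y - ∫ z, f z ∂π) y ∂π)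
          - 2 * ((∫ z, f z ∂π) / (∫ z, g z ∂π)) * ((∫ y, (f y - ∫ z, f z ∂π) * (g y - ∫ z, g z ∂π) ∂π)
            + ∑' k, ((∫ y, (f y - ∫ z, f z ∂π) * (kop κ)^[k + 1] (fun y => g y - ∫ z, g z ∂π) y ∂π)
              + ∫ y, (g y - ∫ z, g z ∂π) * (kop κ)^[k + 1] (fun y => f y - ∫ z, f z ∂π) y ∂π))
          + ((∫ z, f z ∂π) / (∫ z, g z ∂π)) ^ 2 * ((∫ y, (g y - ∫ z, g z ∂π) ^ 2 ∂π)
            + 2 * ∑' k, ∫ y, (g y - ∫ z, g z ∂π) * (kop κ)^[k + 1] (fun y => g y - ∫ z, g z ∂π) y ∂π))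
          / (∫ z, g z ∂π) ^ 2)))
        ((gaussianReal 0 1).prod (gaussianReal 0 1)) ∧
      TendstoInDistribution (fun (n : ℕ) (x : ℕ → Ω) =>
          Real.sqrt n * ((∑ t ∈ Finset.range n, f (x t)) / (∑ t ∈ Finset.range n, g (x t))
            - (∫ z, f z ∂π) / (∫ z, g z ∂π)))
        atTop Y (fun _ => (Kernel.trajMeasure (X := fun _ : ℕ => Ω) μ₀
          (fun n : ℕ => κ.comap (fun h : (i : ↥(Finset.Iic n)) → Ω => h ⟨n, Finset.mem_Iic.2 le_rfl⟩)
            (measurable_pi_apply _)))) ((gaussianReal 0 1).prod (gaussianReal 0 1)) := by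
  obtain ⟨Z₁, Z₂, hZ₁, hZ₂, hZ, -⟩ :=
    chain_bivariate_clt_exists_of_nHit hπ hmin hε0 hε1 hm hf hg hCf hCg μ₀
  exact ⟨_, hasLaw_ratio_limit hv hZ, chain_ratio_clt_of_nHit hπ hmin hε0 hε1 hm hf hg hCf hCg hv
    μ₀ hZ₁.aemeasurable hZ₂.aemeasurable hZ⟩

end Ratio

end Summit.Ventures.LatticeQCDFlow.Scoring

end
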